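import Literature.MathematicalPhysics.QuantumFieldTheory.Balaban1983to89.B15Norm1102Object

/-!
# `Balaban1983to89.B15Eq06VLocal` — [Balaban1989LargeFieldI] (0.5)–(0.6) p. 176 IN THE V-LOCAL (faithful) FORM over `Setup`: for b01's concrete
# (0.3) `B15.BasicStep.RopReal` (restricted integrals `∫dV⌈_{Z′}` = the V⌈_{Z′ᶜ}-dependent fibre integrals), the double-sum form, the V-dependent
# (0.5)-sums over the OCCURRING regions `Z″`, their positivity under the p. 176 provisos, and (0.6) with the exponent `Σ_X 𝐑(X, V) := log` of the
# (0.5)-sum — the statement the typed leaf `B15.ExpForm06` cannot hold (its `RData.IntOver` is a number: cell DIVERGENCE D-b01.1)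

statement-level skeleton of published theorems with citation tags; proofs where landed; nothing here is a claim about
the Yang–Mills mass gap.

TRACK-A KNIT MODULE, companion of `B15LeafKnit` (HUMAN RULING D-0062; seat `pub-ymgap-dag-n12-a`; `bears_on: R4∕N12`; answers the referee's
consumer note in READ #13 of p409047: *"Consumers of the (0.6) terms (the (2.18) representation in N11∕N13) will need the local form"*).  PDF held
`paper:balaban1989-cmp122-large-field-i` (journal page = PDF page + 174).

THE PRINT (p. 176): *"(𝐑ρ)(V) = Σ_Z ρ(Z″, V) ∫dV⌈_{Z′}ρ(Z, V) / ∫dV⌈_{Z′}ρ(Z″, V). (0.3) … It can be written as a double sum over domains Z′, Z″,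
Z′ ⊂ Z″ᶜ, and the summation over Z′ can be applied to the quotients. … Σ_{Z′⊂Z″ᶜ} ∫dV⌈_{Z′}ρ(Z′∪Z″, V) / ∫dV⌈_{Z′}ρ(Z″, V) = exp Σ_X 𝐑(X, V), (0.5)
… (𝐑ρ)(V) = Σ_{Z″} ρ(Z″, V) exp Σ_X 𝐑(X, V). (0.6)"*

WHAT THIS FILE PROVES (theorems only; 0 `sorry`; axioms standard; no `def`): over pieces `piece : R → Density P k G`, `Z ↦ Z″ = pp Z`, bond
variables `fib Z` of `Z′`:
* `ropReal_eq_doubleSum` — *"a double sum over domains Z′, Z″ … the summation over Z′ … applied to the quotients"*: `(𝐑ρ)(V) = Σ_{Z″} ρ(Z″, V) ·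
  q(Z″, V)` with the V-DEPENDENT (0.5)-sum `q(W, V) = Σ_{Z : Z″(Z) = W} ∫dV⌈_{Z′}ρ(Z, V) ∕ ∫dV⌈_{Z′}ρ(W, V)`, summed over ALL `W` and, since `q(W, ·) = 0`
  off the image of `Z ↦ Z″`, over the OCCURRING regions (`ropReal_eq_doubleSum_image`).
* `quotSumV_pos` — `q(W, V) > 0` at an occurring `W` when every piece's fibre integrals vanish nowhere (p. 176 *"the densities are positive … hence
  the denominators are positive"*).
* `ropReal_expForm_local` — **(0.6) in the V-local form**: `(𝐑ρ)(V) = Σ_{Z″ occurring} ρ(Z″, V) · exp (log q(Z″, V))` — the exponent `Σ_X 𝐑(X, V)` read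
  as the number (0.5) says it is, NOW A FUNCTION OF `V⌈_{Z′ᶜ}` as in print.  (The polymer structure of `Σ_X 𝐑(X, V)` — *"over X such, that X∩Z″ᶜ ≠
  ∅"*, localization and bounds — is [Balaban1989LargeFieldII]'s content and is not expressible at this level either.)
HONEST FRAMING: bookkeeping over b01's `RopReal`∕`fibreIntegral` and r12's fibre-integral API by name; count-neutral; NOT a node discharge and NOT a
conjunct of `DagBinding.B15Leaf` (which reads the scalar datum); one finite four-torus programme at fixed ε; NOT continuum ∕ ℝ⁴ ∕ OS ∕ mass gap ∕ Clay.
-/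

noncomputable section

open scoped BigOperators
open MeasureTheory

namespace Literature.MathematicalPhysics.QuantumFieldTheory.Balaban1983to89.B15Eq06VLocal

open B15.BasicStep (fibreIntegral normTerm RopReal)
open B15Norm1102Object (fibreIntegral_nonneg)

variable {P : Params} {k : ℕ} {G : Type*} [GaugeGroup G] [MeasurableSpace G] [HaarData G] [DecidableEq (PBond P k)]
variable {R : Type*} [Fintype R] [DecidableEq R]

/-- **The double-sum form of (0.3), V-local** (p. 176): `(𝐑ρ)(V) = Σ_W ρ(W, V) · Σ_{Z : Z″(Z) = W} ∫dV⌈_{Z′}ρ(Z, V) ∕ ∫dV⌈_{Z′}ρ(W, V)` (sum over all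
`W`; the inner sum is empty off the image of `Z ↦ Z″`). [cite: Balaban1989LargeFieldI, (0.3), (0.5) p.176] -/
theorem ropReal_eq_doubleSum (piece : R → Density P k G) (pp : R → R) (fib : R → Finset (PBond P k)) (V : GaugeField P k G) :
    RopReal piece pp fib V =
      ∑ W, piece W V * ∑ Z ∈ Finset.univ.filter (fun Z => pp Z = W), fibreIntegral (fib Z) (piece Z) V / fibreIntegral (fib Z) (piece W) V := by
  unfold RopReal
  simp_rw [Finset.mul_sum]
  rw [← Finset.sum_fiberwise Finset.univ pp (fun Z => normTerm (fib Z) (piece (pp Z)) (piece Z) V)]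
  refine Finset.sum_congr rfl fun W _ => Finset.sum_congr rfl fun Z hZ => ?_
  rw [Finset.mem_filter] at hZ
  rw [normTerm, hZ.2]

/-- The same over the OCCURRING regions `Z″` only (the others contribute empty inner sums). [cite: Balaban1989LargeFieldI, (0.5) p.176] -/
theorem ropReal_eq_doubleSum_image (piece : R → Density P k G) (pp : R → R) (fib : R → Finset (PBond P k)) (V : GaugeField P k G) :
    RopReal piece pp fib V =
      ∑ W ∈ Finset.univ.image pp, piece W V *
        ∑ Z ∈ Finset.univ.filter (fun Z => pp Z = W), fibreIntegral (fib Z) (piece Z) V / fibreIntegral (fib Z) (piece W) V := by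
  rw [ropReal_eq_doubleSum]
  symm
  refine Finset.sum_subset (Finset.subset_univ _) (fun W _ hW => ?_)
  have hempty : Finset.univ.filter (fun Z => pp Z = W) = ∅ :=
    Finset.filter_eq_empty_iff.2 (fun Z _ hZ => hW (Finset.mem_image.2 ⟨Z, Finset.mem_univ _, hZ⟩))
  rw [hempty, Finset.sum_empty, mul_zero]

/-- Fibre integrals that vanish nowhere are POSITIVE (they are nonnegative). [cite: Balaban1989LargeFieldI, (0.3) p.176 (proviso)] -/
theorem fibreIntegral_pos_of_ne_zero (s : Finset (PBond P k)) (f : Density P k G) (V : GaugeField P k G) (h : fibreIntegral s f V ≠ 0) :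
    0 < fibreIntegral s f V :=
  lt_of_le_of_ne (fibreIntegral_nonneg s f V) (Ne.symm h)

/-- **Positivity of the V-local (0.5)-sum at an occurring region** under the p. 176 provisos (every piece's fibre integrals nowhere zero): a
non-empty sum of positive quotients. [cite: Balaban1989LargeFieldI, (0.5) p.176] -/
theorem quotSumV_pos (piece : R → Density P k G) (pp : R → R) (fib : R → Finset (PBond P k))
    (hnum : ∀ Z V, fibreIntegral (fib Z) (piece Z) V ≠ 0) (hden : ∀ Z V, fibreIntegral (fib Z) (piece (pp Z)) V ≠ 0)
    {W : R} (hW : W ∈ Finset.univ.image pp) (V : GaugeField P k G) :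
    0 < ∑ Z ∈ Finset.univ.filter (fun Z => pp Z = W), fibreIntegral (fib Z) (piece Z) V / fibreIntegral (fib Z) (piece W) V := by
  obtain ⟨Z₀, _, hZ₀⟩ := Finset.mem_image.1 hW
  refine Finset.sum_pos (fun Z hZ => ?_) ⟨Z₀, Finset.mem_filter.2 ⟨Finset.mem_univ _, hZ₀⟩⟩
  have hZW : pp Z = W := (Finset.mem_filter.1 hZ).2
  refine div_pos (fibreIntegral_pos_of_ne_zero _ _ _ (hnum Z V)) ?_
  rw [← hZW]
  exact fibreIntegral_pos_of_ne_zero _ _ _ (hden Z V)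

/-- **(0.6) IN THE V-LOCAL FORM** (p. 176): under the p. 176 provisos, `(𝐑ρ)(V) = Σ_{Z″ occurring} ρ(Z″, V) · exp (Σ_X 𝐑(X, V))` with the exponent
READ as the logarithm of the V-dependent (0.5)-sum — a function of `V⌈_{Z′ᶜ}` as printed (each fibre integral is independent of its own fibre
variables, r12's `fibreIntegral_update_self`). [cite: Balaban1989LargeFieldI, (0.5)–(0.6) p.176] -/
theorem ropReal_expForm_local (piece : R → Density P k G) (pp : R → R) (fib : R → Finset (PBond P k))
    (hnum : ∀ Z V, fibreIntegral (fib Z) (piece Z) V ≠ 0) (hden : ∀ Z V, fibreIntegral (fib Z) (piece (pp Z)) V ≠ 0) (V : GaugeField P k G) :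
    RopReal piece pp fib V =
      ∑ W ∈ Finset.univ.image pp, piece W V *
        Real.exp (Real.log (∑ Z ∈ Finset.univ.filter (fun Z => pp Z = W),
          fibreIntegral (fib Z) (piece Z) V / fibreIntegral (fib Z) (piece W) V)) := by
  rw [ropReal_eq_doubleSum_image]
  refine Finset.sum_congr rfl (fun W hW => ?_)
  rw [Real.exp_log (quotSumV_pos piece pp fib hnum hden hW V)]

end Literature.MathematicalPhysics.QuantumFieldTheory.Balaban1983to89.B15Eq06VLocal

end
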